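import Summits.ResolutionOfSingularities.ResolutionOfSingularities.Theorems.EquisingularLiftEquisingularLiftNatNoseDescEngine
import Summits.ResolutionOfSingularities.ResolutionOfSingularities.Theorems.EquisingularLiftEquisingularLiftNatNoseDescSharpLift
import Summits.ResolutionOfSingularities.ResolutionOfSingularities.Theorems.EquisingularLiftEquisingularLiftNatResidueHypDefsE11
import HarnessLib

/-!
# [OURS · L1 W4.5(b) · EL♮ / EL♮(3) · D18♯ «SMOOTH-PARAMETER DESCENT DOOR», engine] ★★ `descDoorSharp_elnat : DescDoorSharp k n H ι → ELNatConclusionO k n H ι`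

leafhand-res-equisingularlift-1 g0 (prover, 2026-08-30; one-generation line-first hand on stmt-ResolutionOfSingularities-20038 / -20148),
executing drawer item (d4) of desk RULING R95 (3) (res-L1-w45b-plan-1 g28, 2026-08-29T16:03Z: «engine = nose-w1 `DescSharpLift` pre-draft
+ ⊙p730092's base-generic `descDoorOver_elnat_of_base`») now that all its inputs are ✓ in the tree: letters ✓ `…NatResidueHypDefsE11`
(res-type-027 g25/g26: `DescDoorAt B k θ`, `DescDoorSharp`, blob E11), the lift ✓ `DescSharp.exists_ringHom_lift` (…NatNoseDescSharpLift,
res-L1-w45b-nose-w1 g8, p741601) and the `O`-uniform D18 engine ✓ `descDoorOver_elnat_of_base` (…NatNoseDescEngine, nose-w1 g8, p730092).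

WHAT.
* `descDoorAt_elnat_of_base` — the `O`-UNIFORM ENGINE READ AT ONE POINT: verbatim ✓ `descDoorOver_elnat_of_base` (same statement and
  proof, adapted from …NatNoseDescEngine) except that the certificate is asked only AT the point `θ₀ = π ∘ (B → O)` (`DescDoorAt B k θ₀ n H ι`)
  instead of at every `θ : B →+* k` (`DescDoorOver B k n H ι`) — the D18 proof calls the door's `∀ θ` clause exactly once, at that `θ₀`
  (step (E1)), so nothing else changes.
* `descDoorSharp_elnat` — ★★ THE D18♯ ENGINE, FACT-FREE, every `n`, no hypothesis on `H`: from `DescDoorSharp k n H ι` = «`N` invertible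
  in `k`, a formally smooth `ℤ[1/N]`-algebra `B`, a point `θ : B →+* k` and a certificate `DescDoorAt B k θ n H ι`»: (E0) `O := 𝕎(k)`,
  `π`, `N ∈ Oˣ` (✓ `DescBase.exists_base`), `ℤ[1/N] → O` the `IsLocalization.Away` lift; (E0♯) LIFT `θ` to `η : B →+* O` with `π ∘ η = θ`
  by ✓ `DescSharp.exists_ringHom_lift` (Mathlib `Algebra.FormallySmooth.exists_mkₐ_comp_eq_of_isAdicComplete`; the compatibility over
  `ℤ[1/N]` is automatic — ring maps out of a localisation of `ℤ` agree, `IsLocalization.ringHom_ext`); then `descDoorAt_elnat_of_base` at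
  `Algebra B O := η.toAlgebra`.
* `descDoorSharp₂_elnat_of_desc₂_elnat` — pure logic for the rung row: any consumer of blob E10 upgrades to blob E11 = E10 ∨ D18♯.
With this file the D18♯ REPLACE «¬blob_E10 ↦ ¬blob_E11» on the nose residue and the drawer D19-ISO ADD «… → ¬DescDoorSharp → …» on the iso
residue are TEXTS-ONLY for the next lead (rung = `Or.elim` of ✓ `nose_desc_rung_three` and `descDoorSharp_elnat`, filed next to this file);
a registration still needs the desk's germ gate (R84/R95: a certified customer in D18♯ ∖ D18 — candidate generic `𝔅_{6,c}`, R96 (3)).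
OURS; NOT a statement of any manuscript ([Hironaka2017] is a candidate under adjudication, nothing of it is asserted); AI-written, weaker
than expert review.  DEF-FREE; no `sorry`; standard axioms.  `--supports stmt-ResolutionOfSingularities-20148 --as helper`, counted 0.
EL♮(3) is NOT proved here; resolution of singularities in positive characteristic is NOT proved anywhere in this tree.
[cite: StacksProject, Tag 07K9] [cite: Liu2002, Prop. 3.1.9 and Ex. 3.1.10] (method; index only)
-/

set_option linter.dupNamespace false -- mandated namespace `Summit.<Summit>.<Problem>` of this single-conjunct summit
set_option linter.overlappingInstances false -- signatures carry `[IsDomain O] [IsDiscreteValuationRing O]`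
noncomputable section
open CategoryTheory CategoryTheory.Limits AlgebraicGeometry TopologicalSpace Topology IsLocalRing
open MvPolynomial
open Literature.AlgebraicGeometry.Resolution
open Literature.AlgebraicGeometry.Motives
open AlgebraicGeometry.Scheme.IdealSheafData
open Summit.ResolutionOfSingularities.ResolutionOfSingularities.Cruxes.EquisingularLift.StrataSplit

namespace Summit.ResolutionOfSingularities.ResolutionOfSingularities.Cruxes.EquisingularLiftNat.Sections

/-- ★ **`descDoorAt_elnat_of_base` — the `O`-UNIFORM D18 engine read AT ONE POINT.**  For ANY base ring `B`, any local Noetherian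
`B`-algebra `O` with `Spec O` regular, any surjection `π : O → k` onto the field `k`, and a descent certificate AT the point
`θ₀ = π ∘ (B → O)` (`DescDoorAt B k θ₀ n H ι`): for every graded lift `φ` of `π` and `Y = range (ι ≫ Proj.map φ)`, the tower-and-END clause
of `ELNatConclusionO` over `O`.  Statement and proof = ✓ `descDoorOver_elnat_of_base` verbatim with the door called at `θ₀` only
(adapted from …NatNoseDescEngine, res-L1-w45b-nose-w1 g8). [cite: Liu2002, Prop. 3.1.9 and Ex. 3.1.10]
[OURS · L1 W4.5b · D18♯ engine]; NOT a statement of the manuscript. -/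
theorem descDoorAt_elnat_of_base (B : Type) [CommRing B] (O : Type) [CommRing O] [IsLocalRing O] [IsNoetherianRing O]
    [Algebra B O] (hOreg : Scheme.IsRegular (Spec (.of O)))
    (k : Type) [Field k] (π : O →+* k) (hπ : Function.Surjective π) (n : ℕ) (H : AlgebraicGeometry.Scheme.{0})
    (ι : H ⟶ (Literature.AlgebraicGeometry.Motives.projectiveSpace n k).left)
    (θ₀ : B →+* k) (hθ₀ : θ₀ = π.comp (algebraMap B O)) (hD : DescDoorAt B k θ₀ n H ι) :
    letI := MvPolynomial.gradedAlgebra (σ := Fin (n + 1)) (R := O)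
    letI := MvPolynomial.gradedAlgebra (σ := Fin (n + 1)) (R := k)
    ∀ (φ : MvPolynomial.homogeneousSubmodule (Fin (n + 1)) O →+*ᵍ MvPolynomial.homogeneousSubmodule (Fin (n + 1)) k)
    (hφ' : HomogeneousIdeal.irrelevant (MvPolynomial.homogeneousSubmodule (Fin (n + 1)) k) ≤
      (HomogeneousIdeal.irrelevant (MvPolynomial.homogeneousSubmodule (Fin (n + 1)) O)).map φ),
    (∀ s, φ s = MvPolynomial.map π s) →
    ∀ (Y : Set (AlgebraicGeometry.Proj (MvPolynomial.homogeneousSubmodule (Fin (n + 1)) O))),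
    Y = Set.range (ι ≫ AlgebraicGeometry.Proj.map φ hφ' :
      H ⟶ AlgebraicGeometry.Proj (MvPolynomial.homogeneousSubmodule (Fin (n + 1)) O)) →
    ∃ (P' : AlgebraicGeometry.Scheme.{0}) (σ : P' ⟶ AlgebraicGeometry.Proj (MvPolynomial.homogeneousSubmodule (Fin (n + 1)) O))
      (S' : Set P'),
      (∀ Q : (∀ X' : AlgebraicGeometry.Scheme.{0},
          (X' ⟶ AlgebraicGeometry.Proj (MvPolynomial.homogeneousSubmodule (Fin (n + 1)) O)) → Set X' → Prop),
        Q (AlgebraicGeometry.Proj (MvPolynomial.homogeneousSubmodule (Fin (n + 1)) O)) (𝟙 _) Y →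
        (∀ (X' X'' : AlgebraicGeometry.Scheme.{0})
            (σ' : X' ⟶ AlgebraicGeometry.Proj (MvPolynomial.homogeneousSubmodule (Fin (n + 1)) O)) (Y' : Set X')
            (C : X'.IdealSheafData) (τ : X'' ⟶ X'),
          Q X' σ' Y' → IsBlowup τ C → Scheme.IsRegular C.subscheme →
          AlgebraicGeometry.Flat (C.subschemeι ≫ σ' ≫
            (AlgebraicGeometry.Proj.toSpecZero (MvPolynomial.homogeneousSubmodule (Fin (n + 1)) O) ≫
              AlgebraicGeometry.Spec.map (CommRingCat.ofHom
                (algebraMap O (MvPolynomial.homogeneousSubmodule (Fin (n + 1)) O 0))))) →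
          σ' '' (C.support : Set X') ⊆ {x | ¬ IsGenericPoint x Y} →
          (C.support : Set X') ∩ (σ' ≫
            (AlgebraicGeometry.Proj.toSpecZero (MvPolynomial.homogeneousSubmodule (Fin (n + 1)) O) ≫
              AlgebraicGeometry.Spec.map (CommRingCat.ofHom
                (algebraMap O (MvPolynomial.homogeneousSubmodule (Fin (n + 1)) O 0))))) ⁻¹' {IsLocalRing.closedPoint O} ⊆ Y' →
          Q X'' (τ ≫ σ') (closure (τ ⁻¹' (Y' \ (C.support : Set X'))))) →
        Q P' σ S') ∧
      Scheme.IsRegular (vanishingIdeal (⟨closure S', isClosed_closure⟩ : Closeds P')).subscheme := by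
  letI := MvPolynomial.gradedAlgebra (σ := Fin (n + 1)) (R := O)
  letI := MvPolynomial.gradedAlgebra (σ := Fin (n + 1)) (R := k)
  letI := MvPolynomial.gradedAlgebra (σ := Fin (n + 1)) (R := B)
  intro φ hφ' hφ Y hY
  classical
  subst hθ₀
  obtain ⟨s, hEF, hCS, hTOK⟩ := hD
  subst hY
  -- the ambient `P = ℙⁿ_O`, its structure morphism `q`, and the TOP SQUARES (E1)
  set q : Proj (homogeneousSubmodule (Fin (n + 1)) O) ⟶ Spec (.of O) :=
    Proj.toSpecZero (homogeneousSubmodule (Fin (n + 1)) O) ≫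
      Spec.map (CommRingCat.ofHom (algebraMap O (homogeneousSubmodule (Fin (n + 1)) O 0))) with hq
  set qB : Proj (homogeneousSubmodule (Fin (n + 1)) B) ⟶ Spec (.of B) :=
    Proj.toSpecZero (homogeneousSubmodule (Fin (n + 1)) B) ≫
      Spec.map (CommRingCat.ofHom (algebraMap B (homogeneousSubmodule (Fin (n + 1)) B 0))) with hqB
  -- `j : ℙⁿ_k → ℙⁿ_O`, the special fibre (the crux's `Proj.map φ`)
  have hP := ProjectiveAmbientFibre.isPullback_projMap π φ hφ hπ hφ'
  set J : Proj (homogeneousSubmodule (Fin (n + 1)) k) ⟶ Proj (homogeneousSubmodule (Fin (n + 1)) O) :=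
    Proj.map φ hφ' with hJ
  haveI : IsClosedImmersion (Spec.map (CommRingCat.ofHom π)) := IsClosedImmersion.spec_of_surjective _ hπ
  haveI hJci : IsClosedImmersion J := MorphismProperty.IsStableUnderBaseChange.of_isPullback hP.flip inferInstance
  -- `ι_O : ℙⁿ_O → ℙⁿ_B`, the base change of `Spec O → Spec B`
  set ιO : Proj (homogeneousSubmodule (Fin (n + 1)) O) ⟶ Proj (homogeneousSubmodule (Fin (n + 1)) B) :=
    Proj.map (ProjBaseChangeRing.mapGraded B O (Fin (n + 1))) (ProjBaseChangeRing.irrelevant_le_map B O (Fin (n + 1))) with hιO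
  have HO : IsPullback ιO q qB (specOfAlgebra B O) := ProjBaseChangeRing.isPullback_projMap' B O
  -- `ι_k := j ≫ ι_O = Proj.map (φ ∘ (B[x] → O[x]))`, in the pasted square over `Spec (π ∘ g)`
  set θ : B →+* k := π.comp (algebraMap B O) with hθ
  set ψ : homogeneousSubmodule (Fin (n + 1)) B →+*ᵍ homogeneousSubmodule (Fin (n + 1)) k :=
    φ.comp (ProjBaseChangeRing.mapGraded B O (Fin (n + 1))) with hψ
  have hψθ : ∀ t, ψ t = MvPolynomial.map θ t := by
    intro t
    show φ (ProjBaseChangeRing.mapGraded B O (Fin (n + 1)) t) = MvPolynomial.map (π.comp (algebraMap B O)) t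
    rw [ProjBaseChangeRing.mapGraded_apply, hφ, MvPolynomial.map_map]
  have hψ' : HomogeneousIdeal.irrelevant (homogeneousSubmodule (Fin (n + 1)) k) ≤
      (HomogeneousIdeal.irrelevant (homogeneousSubmodule (Fin (n + 1)) B)).map ψ :=
    HomogeneousIdeal.irrelevant_le_map_comp (ProjBaseChangeRing.irrelevant_le_map B O (Fin (n + 1))) hφ'
  have hcompι : (Proj.map ψ hψ' : (Literature.AlgebraicGeometry.Motives.projectiveSpace n k).left ⟶
      Proj (homogeneousSubmodule (Fin (n + 1)) B)) = J ≫ ιO :=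
    Proj.map_comp _ _ (ProjBaseChangeRing.irrelevant_le_map B O (Fin (n + 1))) hφ'
  have hsqk : IsPullback (Proj.map ψ hψ' : (Literature.AlgebraicGeometry.Motives.projectiveSpace n k).left ⟶
        Proj (homogeneousSubmodule (Fin (n + 1)) B))
      (Proj.toSpecZero (homogeneousSubmodule (Fin (n + 1)) k) ≫
        Spec.map (CommRingCat.ofHom (algebraMap k (homogeneousSubmodule (Fin (n + 1)) k 0))))
      qB (Spec.map (CommRingCat.ofHom θ)) := by
    have e : Spec.map (CommRingCat.ofHom θ) = Spec.map (CommRingCat.ofHom π) ≫ specOfAlgebra B O := by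
      rw [hθ, CommRingCat.ofHom_comp, Spec.map_comp]
    rw [hcompι, e]
    exact hP.paste_horiz HO
  -- the door's k-side certificate, CALLED on the standard fibre through `ℙⁿ_O`
  have hT : DescTransformOK (s.comap (Proj.map ψ hψ' :
      (Literature.AlgebraicGeometry.Motives.projectiveSpace n k).left ⟶ Proj (homogeneousSubmodule (Fin (n + 1)) B)))
      (𝟙 (Literature.AlgebraicGeometry.Motives.projectiveSpace n k).left) (Set.range ι) (Set.range ι) :=
    hTOK ψ hψ' hψθ hsqk
  -- the closed image `Y = j '' range ι` lies in the special fibre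
  let ι' : H ⟶ Proj (homogeneousSubmodule (Fin (n + 1)) k) := ι
  have hYc : J '' Set.range ι = Set.range (ι ≫ Proj.map φ hφ') := by
    rw [Scheme.Hom.comp_base, TopCat.coe_comp, Set.range_comp]; rfl
  have hrangeJ : Set.range J = q ⁻¹' {IsLocalRing.closedPoint O} := by
    rw [range_eq_preimage_of_isPullback hP, range_specMap_of_surjective_of_field π hπ]
  have hsub : Set.range (ι ≫ Proj.map φ hφ') ⊆ q ⁻¹' {IsLocalRing.closedPoint O} := by
    rw [← hYc, ← hrangeJ]
    exact Set.image_subset_range _ _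
  -- the ambient is smooth over `Spec O`, hence regular and locally Noetherian
  obtain ⟨hsm, -⟩ := stub_projectiveAmbientSmoothProper O n
  haveI := hsm
  have hPnoeth : IsLocallyNoetherian (Proj (homogeneousSubmodule (Fin (n + 1)) O)) :=
    LocallyOfFiniteType.isLocallyNoetherian q
  have hPreg : Scheme.IsRegular (Proj (homogeneousSubmodule (Fin (n + 1)) O)) := Scheme.IsRegular.of_smooth q hOreg
  -- EL♮'s HORIZONTAL induction principle as a stage predicate over the fixed base (K5′'s `⋂ Q` idiom)
  obtain ⟨Ch, hCh⟩ : ∃ Ch : ∀ X' : Scheme.{0}, (X' ⟶ Proj (homogeneousSubmodule (Fin (n + 1)) O)) → Set X' → Prop,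
      ∀ (X₁ : Scheme.{0}) (σ₁ : X₁ ⟶ Proj (homogeneousSubmodule (Fin (n + 1)) O)) (S₁ : Set X₁), Ch X₁ σ₁ S₁ ↔
      ∀ Q : (∀ X' : Scheme.{0}, (X' ⟶ Proj (homogeneousSubmodule (Fin (n + 1)) O)) → Set X' → Prop),
        Q (Proj (homogeneousSubmodule (Fin (n + 1)) O)) (𝟙 _) (Set.range (ι ≫ Proj.map φ hφ')) →
        (∀ (X' X'' : Scheme.{0}) (σ' : X' ⟶ Proj (homogeneousSubmodule (Fin (n + 1)) O)) (Y' : Set X')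
          (C : X'.IdealSheafData) (τ : X'' ⟶ X'), Q X' σ' Y' → IsBlowup τ C → Scheme.IsRegular C.subscheme →
          Flat (C.subschemeι ≫ σ' ≫ q) →
          σ' '' (C.support : Set X') ⊆ {x | ¬ IsGenericPoint x (Set.range (ι ≫ Proj.map φ hφ'))} →
          (C.support : Set X') ∩ (σ' ≫ q) ⁻¹' {IsLocalRing.closedPoint O} ⊆ Y' →
          Q X'' (τ ≫ σ') (closure (τ ⁻¹' (Y' \ (C.support : Set X'))))) →
        Q X₁ σ₁ S₁ := ⟨_, fun _ _ _ => Iff.rfl⟩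
  have hStep : ∀ (X' X'' : Scheme.{0}) (σ' : X' ⟶ Proj (homogeneousSubmodule (Fin (n + 1)) O)) (S' : Set X')
      (C : X'.IdealSheafData) (τ : X'' ⟶ X'),
      Ch X' σ' S' → IsBlowup τ C → Scheme.IsRegular C.subscheme → Flat (C.subschemeι ≫ σ' ≫ q) →
      σ' '' (C.support : Set X') ⊆ {x | ¬ IsGenericPoint x (Set.range (ι ≫ Proj.map φ hφ'))} →
      (C.support : Set X') ∩ (σ' ≫ q) ⁻¹' {IsLocalRing.closedPoint O} ⊆ S' →
      Ch X'' (τ ≫ σ') (closure (τ ⁻¹' (S' \ (C.support : Set X')))) :=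
    fun X' X'' σ' S' C τ h hb hr hfl hg' hE => (hCh _ _ _).mpr fun Q h0 hs =>
      hs X' X'' σ' S' C τ ((hCh X' σ' S').mp h Q h0 hs) hb hr hfl hg' hE
  have hCh₀ : Ch (Proj (homogeneousSubmodule (Fin (n + 1)) O)) (𝟙 _) (Set.range (ι ≫ Proj.map φ hφ')) :=
    (hCh _ _ _).mpr fun Q h0 _ => h0
  -- the seeds of the two chains
  have HO₀ : IsPullback ιO (𝟙 _ ≫ q) qB (specOfAlgebra B O) := by rw [Category.id_comp]; exact HO
  have hsq₀ : IsPullback J (Proj.toSpecZero (homogeneousSubmodule (Fin (n + 1)) k) ≫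
      Spec.map (CommRingCat.ofHom (algebraMap k (homogeneousSubmodule (Fin (n + 1)) k 0)))) (𝟙 _ ≫ q)
      (Spec.map (CommRingCat.ofHom π)) := by
    rw [Category.id_comp]; exact hP
  have hcomm₀ : J ≫ 𝟙 (Proj (homogeneousSubmodule (Fin (n + 1)) O)) =
      𝟙 (Literature.AlgebraicGeometry.Motives.projectiveSpace n k).left ≫ J := by
    rw [Category.comp_id]; exact (Category.id_comp _).symm
  -- ONE call of the chain (E2)–(E5)
  obtain ⟨hTop, hEnd⟩ :=
    Descent.chain_of_descTransformOK O k π hπ (Proj (homogeneousSubmodule (Fin (n + 1)) O)) q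
      (Set.range (ι ≫ Proj.map φ hφ')) hsub Ch hStep hOreg J (Set.range ι) hYc s qB ιO (𝟙 _)
      (Set.range (ι ≫ Proj.map φ hφ')) hCh₀ hPnoeth hPreg HO₀
      (Proj.map ψ hψ' : (Literature.AlgebraicGeometry.Motives.projectiveSpace n k).left ⟶
        Proj (homogeneousSubmodule (Fin (n + 1)) B))
      J _ hcompι.symm hsq₀ (𝟙 _) hcomm₀ (Set.range ι) hYc hEF hCS hT
  exact ⟨_, _, _, fun Q h0 hs => (hCh _ _ _).mp hTop Q h0 hs, hEnd⟩

/-- ★★ **`descDoorSharp_elnat` — THE D18♯ ENGINE: the smooth-parameter descent-certificate door implies EL♮'s conclusion**, for every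
`n` and with no hypothesis on `H`: `O := 𝕎(k)` (✓ `DescBase.exists_base`: complete, `ker π = 𝔪`, `N ∈ Oˣ`), `ℤ[1/N] → O` the
`IsLocalization.Away` lift, `η : B → O` the formally smooth lift of the given point `θ` (✓ `DescSharp.exists_ringHom_lift`), then
`descDoorAt_elnat_of_base` at `Algebra B O := η.toAlgebra`.  FACT-FREE. [cite: StacksProject, Tag 07K9] [cite: Serre1979, II §5–§6]
[OURS · L1 W4.5b · D18♯ engine]; NOT a statement of the manuscript; EL♮(3) NOT proved. -/
theorem descDoorSharp_elnat (p : ℕ) (hp : p.Prime) (k : Type) [Field k] [CharP k p] [IsAlgClosed k] (n : ℕ)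
    (H : AlgebraicGeometry.Scheme.{0}) (ι : H ⟶ (Literature.AlgebraicGeometry.Motives.projectiveSpace n k).left) :
    DescDoorSharp k n H ι → ELNatConclusionO k n H ι := by
  classical
  letI := MvPolynomial.gradedAlgebra (σ := Fin (n + 1)) (R := k)
  rintro ⟨N, hN, B, _, _, _, θ, hD⟩
  obtain ⟨O, i1, i2, i3, i4, i5, i6, π, hπ, hker, hunit, -⟩ := DescBase.exists_base p hp k N hN
  letI := MvPolynomial.gradedAlgebra (σ := Fin (n + 1)) (R := O)
  unfold ELNatConclusionO
  refine ⟨O, i1, i2, i3, i4, π, hπ, ?_⟩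
  intro φ hφ' hφ Y hY
  -- (E0) `ℤ[1/N] → O`
  have hunit' : IsUnit (algebraMap ℤ O (N : ℤ)) := by simpa using hunit
  letI : Algebra (Localization.Away (N : ℤ)) O := (IsLocalization.Away.lift (N : ℤ) hunit').toAlgebra
  -- the compatibility of `θ` with `ℤ[1/N] → O → k` is automatic: ring maps out of a localisation of `ℤ` agree
  have hcompat : θ.comp (algebraMap (Localization.Away (N : ℤ)) B) = π.comp (algebraMap (Localization.Away (N : ℤ)) O) := by
    refine IsLocalization.ringHom_ext (Submonoid.powers (N : ℤ)) ?_
    exact Subsingleton.elim _ _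
  -- (E0♯) the formally smooth lift of the point `θ`
  obtain ⟨η, hη, -⟩ := DescSharp.exists_ringHom_lift π hπ hker θ hcompat
  letI : Algebra B O := η.toAlgebra
  have hθ₀ : θ = π.comp (algebraMap B O) := by
    rw [RingHom.algebraMap_toAlgebra]
    exact hη.symm
  exact descDoorAt_elnat_of_base B O (Scheme.isRegular_Spec (.of O)) k π hπ n H ι θ hθ₀ hD φ hφ' hφ Y hY

/-- D18 through D18♯ (consistency check, pure composition): `DescDoor k n H ι → ELNatConclusionO k n H ι` factors through
`descDoorSharp_of_descDoor` (✓ …DefsE11) and `descDoorSharp_elnat`. [OURS · pure logic] -/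
theorem descDoor_elnat_via_sharp (p : ℕ) (hp : p.Prime) (k : Type) [Field k] [CharP k p] [IsAlgClosed k] (n : ℕ)
    (H : AlgebraicGeometry.Scheme.{0}) (ι : H ⟶ (Literature.AlgebraicGeometry.Motives.projectiveSpace n k).left)
    (h : DescDoor k n H ι) : ELNatConclusionO k n H ι :=
  descDoorSharp_elnat p hp k n H ι (descDoorSharp_of_descDoor k n H ι h)

/-- **Blob E11 ⇒ EL♮'s conclusion from any consumer of blob E10** (pure logic for the rung row: E11 = E10 ∨ D18♯; the E10 arm is the
given consumer — at `n = 3` ✓ `nose_desc_rung_three` —, the D18♯ arm is `descDoorSharp_elnat`). [OURS · pure logic] -/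
theorem descSharp₂_elnat_of_desc₂_elnat (p : ℕ) (hp : p.Prime) (k : Type) [Field k] [CharP k p] [IsAlgClosed k] (n : ℕ)
    (H : AlgebraicGeometry.Scheme.{0}) (ι : H ⟶ (Literature.AlgebraicGeometry.Motives.projectiveSpace n k).left)
    (h10 : NoseHypHostedNestEquinodalDirectCILiftTowerZeroPrimeSigmaPGBTriplePrimeDesc₂ k n H ι → ELNatConclusionO k n H ι)
    (h : NoseHypHostedNestEquinodalDirectCILiftTowerZeroPrimeSigmaPGBTriplePrimeDescSharp₂ k n H ι) : ELNatConclusionO k n H ι := by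
  rcases h with h₁₀ | hS
  · exact h10 h₁₀
  · exact descDoorSharp_elnat p hp k n H ι hS

end Summit.ResolutionOfSingularities.ResolutionOfSingularities.Cruxes.EquisingularLiftNat.Sections

end
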